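import Summits.AtomisticToContinuum.BoseEinsteinCondensation.Theorems.BECInfDivCoherenceLevyNegativeMomentRieszOneDim
import Summits.AtomisticToContinuum.BoseEinsteinCondensation.Theorems.BECInfDivCoherenceLevyNegativeMomentRieszSplit

/-!
# Crux `LevyNegativeMoment` (stmt-AtomisticToContinuum-9115), line `registered`, stub `stub_rieszSum` —
# part G: assembly of the L-free grid Riesz sum bound

Helper file (lead prover of the line) for the L-free grid Riesz sum bound (stub `stub_rieszSum`):
`|Σ_{q : (ℤ/m)³} cos(2π q·j/m)/‖q̄‖| ≤ 140 · m²/J²` for `m ≥ 8`, where `J = j̄_{k₀} ≥ 1` is the folded size of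
any coordinate `k₀` of the frequency `j` (`abs_rieszSum_le_main`).  Steps: split `q = (a, p)` at `k₀` (part F);
for each transverse `p` the sum over `a` is the real part of a unimodular multiple of the character sum
`T_p = Σ_t ζ^t g_{ρ_p}(t̄)` (`cos_sum_eq_re`), bounded by the piecewise majorant `Φ(r_p)`, `r_p = max(p̄₀, p̄₁)`
(`norm_charSum_le_Phi`: zero / first-order / third-order bound of part D according to `r_p = 0`, `r_p ≤ R`,
`r_p > R`, `R = ⌊m/J⌋`); the transverse sum is dominated by `4 Σ_u (2u+1) Φ(u) ≤ 140 (m/J)²` (part E and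
`four_mul_sum_Phi_le`).
-/

namespace Summit.AtomisticToContinuum.BoseEinsteinCondensation.Cruxes.LevyNegativeMoment.Birth.Riesz

open scoped BigOperators
open Finset

/-! ## The inner sum as the real part of a character sum -/

/-- For `t < m` the folded coordinate needs no reduction mod `m`. [folklore] -/
theorem bar_mod_of_lt {m t : ℕ} (ht : t < m) : min (t % m) (m - t % m) = min t (m - t) := by
  rw [Nat.mod_eq_of_lt ht]

/-- The sum over the distinguished coordinate is the real part of `e^{iθ}·T`,
`T = Σ_{t<m} ζ^t g_ρ(t̄)`, `θ = 2πP/m`, `ρ = √Q`. [folklore] -/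
theorem cos_sum_eq_re (m j₀ : ℕ) (P Q : ℝ) (hQ : 0 ≤ Q) :
    ∑ a : Fin m, Real.cos (2 * Real.pi * ((a : ℕ) * (j₀ : ℝ) + P) / m) /
        Real.sqrt (((min (a : ℕ) (m - a) : ℕ) : ℝ) ^ 2 + Q)
      = (Complex.exp (((2 * Real.pi * P / m : ℝ) : ℂ) * Complex.I) *
          ∑ t ∈ range m, ζ⟦m,j₀⟧ ^ t *
            (((Real.sqrt (((min (t % m) (m - t % m) : ℕ) : ℝ) ^ 2 + (Real.sqrt Q) ^ 2))⁻¹ : ℝ) : ℂ)).re := by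
  rw [Fin.sum_univ_eq_sum_range (fun a => Real.cos (2 * Real.pi * ((a : ℕ) * (j₀ : ℝ) + P) / m) /
        Real.sqrt (((min (a : ℕ) (m - a) : ℕ) : ℝ) ^ 2 + Q)) m]
  rw [mul_sum, Complex.re_sum]
  refine sum_congr rfl fun t ht => ?_
  rw [mem_range] at ht
  rw [bar_mod_of_lt ht, Real.sq_sqrt hQ, zeta_pow, ← mul_assoc, ← Complex.exp_add, Complex.re_mul_ofReal]
  have : ((2 * Real.pi * P / m : ℝ) : ℂ) * Complex.I + Complex.I * ((2 * Real.pi * j₀ * t / m : ℝ) : ℂ)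
      = ((2 * Real.pi * ((t : ℕ) * (j₀ : ℝ) + P) / m : ℝ) : ℂ) * Complex.I := by
    push_cast; ring
  rw [this, Complex.exp_ofReal_mul_I_re, div_eq_mul_inv]

/-- Hence `|inner sum| ≤ ‖T‖`. [folklore] -/
theorem abs_cos_sum_le_norm (m j₀ : ℕ) (P Q : ℝ) (hQ : 0 ≤ Q) :
    |∑ a : Fin m, Real.cos (2 * Real.pi * ((a : ℕ) * (j₀ : ℝ) + P) / m) /
        Real.sqrt (((min (a : ℕ) (m - a) : ℕ) : ℝ) ^ 2 + Q)|
      ≤ ‖∑ t ∈ range m, ζ⟦m,j₀⟧ ^ t *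
            (((Real.sqrt (((min (t % m) (m - t % m) : ℕ) : ℝ) ^ 2 + (Real.sqrt Q) ^ 2))⁻¹ : ℝ) : ℂ)‖ := by
  rw [cos_sum_eq_re m j₀ P Q hQ]
  refine (Complex.abs_re_le_norm _).trans ?_
  rw [norm_mul, Complex.norm_exp_ofReal_mul_I, one_mul]

/-! ## The piecewise majorant -/

/-- `g_ρ(x) ≤ 1/x` for `x > 0`. [folklore] -/
theorem inv_sqrt_sq_add_le {x ρ : ℝ} (hx : 0 < x) : (Real.sqrt (x ^ 2 + ρ ^ 2))⁻¹ ≤ x⁻¹ := by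
  apply inv_anti₀ hx
  calc x = Real.sqrt (x ^ 2) := (Real.sqrt_sq hx.le).symm
    _ ≤ Real.sqrt (x ^ 2 + ρ ^ 2) := Real.sqrt_le_sqrt (by nlinarith)

/-- **Per-frequency bound.** For `m ≥ 8`, `j₀ < m` with `J = j̄₀ ≥ 1`, `X = m/J`, `R = ⌊m/J⌋`, `M₀ = m/2`,
`β* = 2M₀/(M₀-1)³`, and a transverse frequency `p` with `r = max(p̄₀, p̄₁)`:
`‖T_p‖ ≤ Φ(r)`, `Φ(0) = X`, `Φ(r) = X/(2r)` for `1 ≤ r ≤ R`, `Φ(r) = (9/2)X³/r³ + X²β*/4` for `r > R`. [folklore] -/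
theorem norm_charSum_le_Phi {m j₀ : ℕ} (hm : 8 ≤ m) (hj : j₀ < m) (hJ : 0 < min j₀ (m - j₀))
    (p : Fin 2 → Fin m) :
    ‖∑ t ∈ range m, ζ⟦m,j₀⟧ ^ t *
        (((Real.sqrt (((min (t % m) (m - t % m) : ℕ) : ℝ) ^ 2 +
          (Real.sqrt (∑ i : Fin 2, ((min (p i : ℕ) (m - p i) : ℕ) : ℝ) ^ 2)) ^ 2))⁻¹ : ℝ) : ℂ)‖
      ≤ (fun u : ℕ =>
          if u = 0 then (m : ℝ) / (min j₀ (m - j₀) : ℕ)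
          else if u ≤ m / min j₀ (m - j₀) then (m : ℝ) / (min j₀ (m - j₀) : ℕ) / (2 * u)
          else 9 / 2 * ((m : ℝ) / (min j₀ (m - j₀) : ℕ)) ^ 3 / (u : ℝ) ^ 3 +
            ((m : ℝ) / (min j₀ (m - j₀) : ℕ)) ^ 2 * (2 * (m / 2 : ℕ) / (((m / 2 : ℕ) : ℝ) - 1) ^ 3) / 4)
        (max (min (p 0 : ℕ) (m - p 0)) (min (p 1 : ℕ) (m - p 1))) := by
  -- names
  set J : ℕ := min j₀ (m - j₀) with hJdef
  set X : ℝ := (m : ℝ) / J with hX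
  set M₀ : ℕ := m / 2 with hM₀
  set βs : ℝ := 2 * (M₀ : ℝ) / ((M₀ : ℝ) - 1) ^ 3 with hβs
  set r : ℕ := max (min (p 0 : ℕ) (m - p 0)) (min (p 1 : ℕ) (m - p 1)) with hr
  set ρ : ℝ := Real.sqrt (∑ i : Fin 2, ((min (p i : ℕ) (m - p i) : ℕ) : ℝ) ^ 2) with hρ
  set g : ℝ → ℝ := fun y => (Real.sqrt (y ^ 2 + ρ ^ 2))⁻¹ with hgdef
  have hg : ∀ y, g y = (Real.sqrt (y ^ 2 + ρ ^ 2))⁻¹ := fun y => rfl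
  have hm2 : 2 ≤ m := by omega
  have hm3 : 3 ≤ m := by omega
  have hm0 : m ≠ 0 := by omega
  have hJpos : (0 : ℝ) < J := by exact_mod_cast hJ
  have hXpos : 0 < X := by rw [hX]; positivity
  -- the Abel gain factor
  have hw : ‖(ζ⟦m,j₀⟧)⁻¹ - 1‖⁻¹ ≤ X / 4 := by
    rw [norm_inv_sub_one (norm_zeta m j₀)]
    refine (inv_norm_zeta_sub_one_le hj hJ).trans (le_of_eq ?_)
    rw [hX, ← hJdef]; ring
  have hw0 : 0 ≤ ‖(ζ⟦m,j₀⟧)⁻¹ - 1‖⁻¹ := by positivity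
  -- fold g into the statement
  show ‖∑ t ∈ range m, ζ⟦m,j₀⟧ ^ t * ((g (min (t % m) (m - t % m) : ℕ) : ℝ) : ℂ)‖ ≤ _
  simp only
  rcases Nat.eq_zero_or_pos r with hr0 | hrpos
  · -- r = 0: both transverse bars vanish, ρ = 0
    rw [if_pos hr0]
    have hb : min (p 0 : ℕ) (m - p 0) = 0 ∧ min (p 1 : ℕ) (m - p 1) = 0 := by
      constructor <;> omega
    have hρ0 : ρ = 0 := by
      rw [hρ, Fin.sum_univ_two, hb.1, hb.2]; simp
    have h := norm_charSum_le_first_zero hg hm2 hj hJ hρ0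
    refine h.trans ?_
    calc ‖(ζ⟦m,j₀⟧)⁻¹ - 1‖⁻¹ * 4 ≤ X / 4 * 4 := by gcongr
      _ = X := by ring
  · rw [if_neg hrpos.ne']
    have hr1 : (1 : ℝ) ≤ r := by exact_mod_cast hrpos
    have hρr : (r : ℝ) ≤ ρ := by
      have hsq := maxBar_sq_le m p
      rw [← hr] at hsq
      calc (r : ℝ) = Real.sqrt ((r : ℝ) ^ 2) := (Real.sqrt_sq (by positivity)).symm
        _ ≤ ρ := Real.sqrt_le_sqrt hsq
    have hρ1 : 1 ≤ ρ := hr1.trans hρr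
    have hρpos : 0 < ρ := by linarith
    by_cases hrR : r ≤ m / J
    · rw [if_pos hrR]
      have h := norm_charSum_le_first hg hm2 hj hJ hρ1
      refine h.trans ?_
      calc ‖(ζ⟦m,j₀⟧)⁻¹ - 1‖⁻¹ * (2 / ρ) ≤ X / 4 * (2 / r) := by
            gcongr
        _ = X / (2 * r) := by field_simp; ring
    · rw [if_neg hrR]
      have h := norm_charSum_le_third hg hm3 hj hJ hρ1
      refine h.trans ?_
      have hM4 : 4 ≤ M₀ := by omega
      have hM1 : 1 ≤ M₀ := by omega
      have hMpos : (0 : ℝ) < (M₀ : ℝ) - 1 := by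
        have : (4 : ℝ) ≤ M₀ := by exact_mod_cast hM4
        linarith
      -- the kink
      have hkink : g ((M₀ : ℝ) - 1) - g ((M₀ : ℝ) + 1) ≤ βs := by
        refine (kink_le hg hρpos.ne' hM1).trans ?_
        have hg1 : g ((M₀ : ℝ) - 1) ≤ ((M₀ : ℝ) - 1)⁻¹ := inv_sqrt_sq_add_le hMpos
        have hg0 : 0 ≤ g ((M₀ : ℝ) - 1) := G_nonneg hg _
        calc 2 * (M₀ : ℝ) * g ((M₀ : ℝ) - 1) ^ 3 ≤ 2 * (M₀ : ℝ) * (((M₀ : ℝ) - 1)⁻¹) ^ 3 := by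
              gcongr
          _ = βs := by rw [hβs]; field_simp
      have hβ0 : 0 ≤ βs := by rw [hβs]; positivity
      have hρ3 : 288 / ρ ^ 3 ≤ 288 / (r : ℝ) ^ 3 := by
        apply div_le_div_of_nonneg_left (by norm_num) (by positivity)
        exact pow_le_pow_left₀ (by positivity) hρr 3
      rw [← hM₀]
      calc ‖(ζ⟦m,j₀⟧)⁻¹ - 1‖⁻¹ ^ 3 * (288 / ρ ^ 3)
            + ‖(ζ⟦m,j₀⟧)⁻¹ - 1‖⁻¹ ^ 2 * (4 * (g ((M₀ : ℕ) - 1 : ℝ) - g ((M₀ : ℕ) + 1 : ℝ)))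
          ≤ ‖(ζ⟦m,j₀⟧)⁻¹ - 1‖⁻¹ ^ 3 * (288 / (r : ℝ) ^ 3)
            + ‖(ζ⟦m,j₀⟧)⁻¹ - 1‖⁻¹ ^ 2 * (4 * βs) := by
            gcongr
        _ ≤ (X / 4) ^ 3 * (288 / (r : ℝ) ^ 3) + (X / 4) ^ 2 * (4 * βs) := by
            gcongr
        _ = 9 / 2 * X ^ 3 / (r : ℝ) ^ 3 + X ^ 2 * βs / 4 := by ring

/-! ## The transverse sum of the majorant -/

/-- `4 Σ_{u ≤ m/2} (2u+1) Φ(u) ≤ 140 (m/J)²` for `m ≥ 8`, `1 ≤ J`, `2J ≤ m`. [folklore] -/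
theorem four_mul_sum_Phi_le {m J : ℕ} (hm : 8 ≤ m) (hJ : 1 ≤ J) (hJm : 2 * J ≤ m) :
    4 * ∑ u ∈ range (m / 2 + 1), (2 * (u : ℝ) + 1) *
        (if u = 0 then (m : ℝ) / J
          else if u ≤ m / J then (m : ℝ) / J / (2 * u)
          else 9 / 2 * ((m : ℝ) / J) ^ 3 / (u : ℝ) ^ 3 +
            ((m : ℝ) / J) ^ 2 * (2 * (m / 2 : ℕ) / (((m / 2 : ℕ) : ℝ) - 1) ^ 3) / 4)
      ≤ 140 * ((m : ℝ) / J) ^ 2 := by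
  set X : ℝ := (m : ℝ) / J with hX
  set M₀ : ℕ := m / 2 with hM₀
  set R : ℕ := m / J with hR
  set βs : ℝ := 2 * (M₀ : ℝ) / ((M₀ : ℝ) - 1) ^ 3 with hβs
  have hJpos : (0 : ℝ) < J := by exact_mod_cast hJ
  have hX2 : 2 ≤ X := by
    rw [hX, le_div_iff₀ hJpos]; exact_mod_cast hJm
  have hXpos : 0 < X := by linarith
  have hRX : (R : ℝ) ≤ X := by rw [hR, hX]; exact Nat.cast_div_le
  have hXR : X ≤ R + 1 := by
    rw [hX, hR, div_le_iff₀ hJpos]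
    have h := Nat.lt_div_mul_add (a := m) (b := J) hJ
    have : (m : ℝ) < ((m / J : ℕ) : ℝ) * J + J := by exact_mod_cast h
    nlinarith
  have hM4 : 4 ≤ M₀ := by omega
  have hM4r : (4 : ℝ) ≤ M₀ := by exact_mod_cast hM4
  have hMpos : (0 : ℝ) < (M₀ : ℝ) - 1 := by linarith
  have hβ0 : 0 ≤ βs := by rw [hβs]; positivity
  -- termwise majorant by a sum of four nonnegative pieces
  have hterm : ∀ u ∈ range (M₀ + 1), (2 * (u : ℝ) + 1) *
      (if u = 0 then X else if u ≤ R then X / (2 * u)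
        else 9 / 2 * X ^ 3 / (u : ℝ) ^ 3 + X ^ 2 * βs / 4)
      ≤ (if u = 0 then X else 0) + (if u ≤ R then 3 / 2 * X else 0)
        + (if R < u then 27 / 2 * X ^ 3 * ((u : ℝ) ^ 2)⁻¹ else 0) + 3 / 4 * M₀ * X ^ 2 * βs := by
    intro u hu
    rw [mem_range] at hu
    have huM : (u : ℝ) ≤ M₀ := by exact_mod_cast Nat.lt_succ_iff.mp hu
    have hnn : 0 ≤ (M₀ : ℝ) * X ^ 2 * βs := by positivity
    rcases Nat.eq_zero_or_pos u with h0 | hpos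
    · subst h0
      rw [if_pos rfl, if_pos rfl, if_pos (Nat.zero_le _), if_neg (Nat.not_lt_zero _)]
      linarith
    · have hu1 : (1 : ℝ) ≤ u := by exact_mod_cast hpos
      rw [if_neg hpos.ne', if_neg hpos.ne']
      by_cases huR : u ≤ R
      · rw [if_pos huR, if_pos huR, if_neg (not_lt.mpr huR)]
        have : (2 * (u : ℝ) + 1) * (X / (2 * u)) ≤ 3 / 2 * X := by
          rw [show (2 * (u : ℝ) + 1) * (X / (2 * u)) = (2 * u + 1) * X / (2 * u) by ring,
            div_le_iff₀ (by positivity)]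
          nlinarith
        linarith
      · rw [if_neg huR, if_neg huR, if_pos (not_le.mp huR)]
        have hupos : (0 : ℝ) < u := by linarith
        have e1 : (2 * (u : ℝ) + 1) ≤ 3 * u := by linarith
        calc (2 * (u : ℝ) + 1) * (9 / 2 * X ^ 3 / (u : ℝ) ^ 3 + X ^ 2 * βs / 4)
            ≤ (3 * u) * (9 / 2 * X ^ 3 / (u : ℝ) ^ 3 + X ^ 2 * βs / 4) := by
              gcongr
          _ = 27 / 2 * X ^ 3 * ((u : ℝ) ^ 2)⁻¹ + 3 / 4 * u * X ^ 2 * βs := by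
              field_simp; ring
          _ ≤ 27 / 2 * X ^ 3 * ((u : ℝ) ^ 2)⁻¹ + 3 / 4 * M₀ * X ^ 2 * βs := by
              gcongr
          _ = 0 + 0 + 27 / 2 * X ^ 3 * ((u : ℝ) ^ 2)⁻¹ + 3 / 4 * M₀ * X ^ 2 * βs := by ring
  have hsum := sum_le_sum hterm
  rw [sum_add_distrib, sum_add_distrib, sum_add_distrib] at hsum
  -- evaluate / bound the four pieces
  have p1 : ∑ u ∈ range (M₀ + 1), (if u = 0 then X else 0) = X := by
    rw [sum_ite_eq']; simp
  have p2 : ∑ u ∈ range (M₀ + 1), (if u ≤ R then 3 / 2 * X else 0) ≤ (R + 1) * (3 / 2 * X) := by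
    rw [← sum_filter, sum_const, nsmul_eq_mul]
    gcongr
    have : (range (M₀ + 1)).filter (fun u => u ≤ R) ⊆ range (R + 1) := by
      intro u hu; simp only [mem_filter, mem_range] at hu ⊢; omega
    exact_mod_cast (card_le_card this).trans (by simp)
  have p3 : ∑ u ∈ range (M₀ + 1), (if R < u then 27 / 2 * X ^ 3 * ((u : ℝ) ^ 2)⁻¹ else 0)
      ≤ 27 / 2 * X ^ 3 * (2 / (R + 1 : ℝ)) := by
    rw [← sum_filter]
    have : ∑ u ∈ (range (M₀ + 1)).filter (fun u => R < u), 27 / 2 * X ^ 3 * ((u : ℝ) ^ 2)⁻¹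
        = 27 / 2 * X ^ 3 * ∑ u ∈ (range (M₀ + 1)).filter (fun u => R < u), ((u : ℝ) ^ 2)⁻¹ := by
      rw [mul_sum]
    rw [this]
    gcongr
    calc ∑ u ∈ (range (M₀ + 1)).filter (fun u => R < u), ((u : ℝ) ^ 2)⁻¹
        ≤ ∑ u ∈ Ioo R (M₀ + 1), ((u : ℝ) ^ 2)⁻¹ := by
          apply sum_le_sum_of_subset_of_nonneg
          · intro u hu; simp only [mem_filter, mem_range] at hu; simp only [mem_Ioo]; omega
          · intro u _ _; positivity
      _ ≤ 2 / (R + 1 : ℝ) := sum_Ioo_inv_sq_le R (M₀ + 1)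
  have p4 : ∑ _u ∈ range (M₀ + 1), 3 / 4 * (M₀ : ℝ) * X ^ 2 * βs = (M₀ + 1) * (3 / 4 * M₀ * X ^ 2 * βs) := by
    rw [sum_const, card_range, nsmul_eq_mul]; push_cast; ring
  -- polynomial fact for the kink piece: M₀²(M₀+1) ≤ 3 (M₀-1)³ for M₀ ≥ 4
  have hpoly : (M₀ : ℝ) ^ 2 * (M₀ + 1) ≤ 3 * ((M₀ : ℝ) - 1) ^ 3 := by
    nlinarith [mul_nonneg (mul_nonneg (sub_nonneg.mpr hM4r) (sub_nonneg.mpr hM4r)) (sub_nonneg.mpr hM4r),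
      mul_nonneg (sub_nonneg.mpr hM4r) (sub_nonneg.mpr hM4r), sub_nonneg.mpr hM4r]
  have p4' : (M₀ + 1) * (3 / 4 * (M₀ : ℝ) * X ^ 2 * βs) ≤ 9 / 2 * X ^ 2 := by
    rw [hβs]
    rw [show (M₀ + 1) * (3 / 4 * (M₀ : ℝ) * X ^ 2 * (2 * (M₀ : ℝ) / ((M₀ : ℝ) - 1) ^ 3))
        = X ^ 2 * (3 / 2) * ((M₀ : ℝ) ^ 2 * (M₀ + 1) / ((M₀ : ℝ) - 1) ^ 3) by field_simp; ring]
    rw [show 9 / 2 * X ^ 2 = X ^ 2 * (3 / 2) * 3 by ring]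
    gcongr
    rw [div_le_iff₀ (by positivity)]
    exact hpoly
  have p2' : ((R : ℝ) + 1) * (3 / 2 * X) ≤ 3 / 2 * X ^ 2 + 3 / 2 * X := by nlinarith
  have p3' : 27 / 2 * X ^ 3 * (2 / (R + 1 : ℝ)) ≤ 27 * X ^ 2 := by
    have h1 : X / (R + 1 : ℝ) ≤ 1 := (div_le_one (by positivity)).mpr hXR
    have e : 27 / 2 * X ^ 3 * (2 / (R + 1 : ℝ)) = 27 * X ^ 2 * (X / (R + 1)) := by ring
    rw [e]
    have hx2 : 0 ≤ 27 * X ^ 2 := by positivity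
    nlinarith
  have hX1 : X + 3 / 2 * X ≤ 5 / 4 * X ^ 2 := by nlinarith
  have total : ∑ u ∈ range (M₀ + 1), (2 * (u : ℝ) + 1) *
      (if u = 0 then X else if u ≤ R then X / (2 * u)
        else 9 / 2 * X ^ 3 / (u : ℝ) ^ 3 + X ^ 2 * βs / 4)
      ≤ X + (R + 1) * (3 / 2 * X) + 27 / 2 * X ^ 3 * (2 / (R + 1 : ℝ))
          + (M₀ + 1) * (3 / 4 * M₀ * X ^ 2 * βs) := by
    refine hsum.trans ?_
    rw [p1, p4]
    linarith [p2, p3]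
  linarith [total, p2', p3', p4', hX1]

/-! ## The main bound -/

/-- **Main case.** For `m ≥ 8` and a coordinate `k₀` with `J = j̄_{k₀} ≥ 1`:
`|Σ_q cos(2π q·j/m)/‖q̄‖| ≤ 140 m²/J²`. [folklore] -/
theorem abs_rieszSum_le_main {m : ℕ} (hm : 8 ≤ m) (j : Fin 3 → Fin m) (k₀ : Fin 3)
    (hJ : 0 < min (j k₀ : ℕ) (m - j k₀)) :
    |∑ q : Fin 3 → Fin m, Real.cos (2 * Real.pi * (∑ k, ((q k : ℕ) : ℝ) * ((j k : ℕ) : ℝ)) / m) /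
        Real.sqrt (∑ k, ((min (q k : ℕ) (m - (q k : ℕ)) : ℕ) : ℝ) ^ 2)|
      ≤ 140 * ((m : ℝ) / (min (j k₀ : ℕ) (m - j k₀) : ℕ)) ^ 2 := by
  have hj : (j k₀ : ℕ) < m := (j k₀).isLt
  have hJm : 2 * min (j k₀ : ℕ) (m - j k₀) ≤ m := by omega
  rw [sum_pi_three_split m k₀]
  -- rewrite each inner sum
  have hinner : ∀ p : Fin 2 → Fin m,
      ∑ a : Fin m, Real.cos (2 * Real.pi * (∑ k, ((Fin.insertNth (α := fun _ => Fin m) k₀ a p k : ℕ) : ℝ)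
          * ((j k : ℕ) : ℝ)) / m) /
        Real.sqrt (∑ k, ((min (Fin.insertNth (α := fun _ => Fin m) k₀ a p k : ℕ)
          (m - (Fin.insertNth (α := fun _ => Fin m) k₀ a p k : ℕ)) : ℕ) : ℝ) ^ 2)
      = ∑ a : Fin m, Real.cos (2 * Real.pi * ((a : ℕ) * ((j k₀ : ℕ) : ℝ)
          + ∑ i : Fin 2, ((p i : ℕ) : ℝ) * ((j (k₀.succAbove i) : ℕ) : ℝ)) / m) /
        Real.sqrt (((min (a : ℕ) (m - a) : ℕ) : ℝ) ^ 2 +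
          ∑ i : Fin 2, ((min (p i : ℕ) (m - p i) : ℕ) : ℝ) ^ 2) := by
    intro p
    refine Fintype.sum_congr _ _ fun a => ?_
    rw [phase_split, barSq_split]
  simp_rw [hinner]
  refine (abs_sum_le_sum_abs _ _).trans ?_
  have hQ : ∀ p : Fin 2 → Fin m, (0 : ℝ) ≤ ∑ i : Fin 2, ((min (p i : ℕ) (m - p i) : ℕ) : ℝ) ^ 2 :=
    fun p => by positivity
  calc ∑ p : Fin 2 → Fin m, |∑ a : Fin m, Real.cos (2 * Real.pi * ((a : ℕ) * ((j k₀ : ℕ) : ℝ)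
          + ∑ i : Fin 2, ((p i : ℕ) : ℝ) * ((j (k₀.succAbove i) : ℕ) : ℝ)) / m) /
        Real.sqrt (((min (a : ℕ) (m - a) : ℕ) : ℝ) ^ 2 +
          ∑ i : Fin 2, ((min (p i : ℕ) (m - p i) : ℕ) : ℝ) ^ 2)|
      ≤ ∑ p : Fin 2 → Fin m, (fun u : ℕ =>
          if u = 0 then (m : ℝ) / (min (j k₀ : ℕ) (m - j k₀) : ℕ)
          else if u ≤ m / min (j k₀ : ℕ) (m - j k₀) then (m : ℝ) / (min (j k₀ : ℕ) (m - j k₀) : ℕ) / (2 * u)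
          else 9 / 2 * ((m : ℝ) / (min (j k₀ : ℕ) (m - j k₀) : ℕ)) ^ 3 / (u : ℝ) ^ 3 +
            ((m : ℝ) / (min (j k₀ : ℕ) (m - j k₀) : ℕ)) ^ 2 *
              (2 * (m / 2 : ℕ) / (((m / 2 : ℕ) : ℝ) - 1) ^ 3) / 4)
        (max (min (p 0 : ℕ) (m - p 0)) (min (p 1 : ℕ) (m - p 1))) := by
        refine sum_le_sum fun p _ => ?_
        exact (abs_cos_sum_le_norm m (j k₀) _ _ (hQ p)).trans (norm_charSum_le_Phi hm hj hJ p)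
    _ ≤ 4 * ∑ u ∈ range (m / 2 + 1), (2 * (u : ℝ) + 1) *
        (if u = 0 then (m : ℝ) / (min (j k₀ : ℕ) (m - j k₀) : ℕ)
          else if u ≤ m / min (j k₀ : ℕ) (m - j k₀) then
            (m : ℝ) / (min (j k₀ : ℕ) (m - j k₀) : ℕ) / (2 * u)
          else 9 / 2 * ((m : ℝ) / (min (j k₀ : ℕ) (m - j k₀) : ℕ)) ^ 3 / (u : ℝ) ^ 3 +
            ((m : ℝ) / (min (j k₀ : ℕ) (m - j k₀) : ℕ)) ^ 2 *
              (2 * (m / 2 : ℕ) / (((m / 2 : ℕ) : ℝ) - 1) ^ 3) / 4) := by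
        refine sum_pi_two_le (m := m) (Φ := fun u : ℕ =>
          if u = 0 then (m : ℝ) / (min (j k₀ : ℕ) (m - j k₀) : ℕ)
          else if u ≤ m / min (j k₀ : ℕ) (m - j k₀) then
            (m : ℝ) / (min (j k₀ : ℕ) (m - j k₀) : ℕ) / (2 * u)
          else 9 / 2 * ((m : ℝ) / (min (j k₀ : ℕ) (m - j k₀) : ℕ)) ^ 3 / (u : ℝ) ^ 3 +
            ((m : ℝ) / (min (j k₀ : ℕ) (m - j k₀) : ℕ)) ^ 2 *
              (2 * (m / 2 : ℕ) / (((m / 2 : ℕ) : ℝ) - 1) ^ 3) / 4) (fun u => ?_)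
        have hM4 : 4 ≤ m / 2 := by omega
        have : (0 : ℝ) < ((m / 2 : ℕ) : ℝ) - 1 := by
          have : (4 : ℝ) ≤ (m / 2 : ℕ) := by exact_mod_cast hM4
          linarith
        split_ifs <;> positivity
    _ ≤ 140 * ((m : ℝ) / (min (j k₀ : ℕ) (m - j k₀) : ℕ)) ^ 2 :=
        four_mul_sum_Phi_le hm (Nat.succ_le_of_lt hJ) hJm

end Summit.AtomisticToContinuum.BoseEinsteinCondensation.Cruxes.LevyNegativeMoment.Birth.Riesz
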